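import Summits.QuantumFields.YangMills.Theorems.FluctuationComparisonRegPrIntLPolymerPinAlgebra
import Literature.MathematicalPhysics.QuantumFieldTheory.Balaban1983to89.T3MinimiserStabilityReduction
import Literature.MathematicalPhysics.QuantumFieldTheory.Balaban1983to89.T3PrintedRegularMinimiser
import Literature.MathematicalPhysics.QuantumFieldTheory.Balaban1983to89.T3OrbitAverage
import Literature.MathematicalPhysics.QuantumFieldTheory.Balaban1983to89.B12ContinuousTransportInvariance
import Literature.MathematicalPhysics.QuantumFieldTheory.Balaban1983to89.Node00.CanonicalTransportOfRecord
import HarnessLib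

/-!
# S2β AND GRAD∘ FROM THE POLYMER FORM OF THE FLUCTUATION PART — AND THE POLYMER FORM FROM ONE POLYMER-NORM CLAUSE (texts inline, def-free)

Cell `ym3-torus` (YM ladder rung R3 = continuum `SU(2)` Yang–Mills on the three-torus — a RUNG, NOT d = 4, NOT infinite volume, NOT a mass gap, NOT Clay).  Width seat
`ym-ust-20520-w3` (gen 20, LEAD-20520 by lineage); `--supports stmt-QuantumFields-20520 --as helper`, count-neutral, definition-free, default heartbeats.

WHAT.  Ideator `ym-r3-idea-1` g24's LINE g24-3 «polymer_form» (`Cruxes/FluctuationComparisonRegPrIntL/Lines/polymer_form.lean` v2 sha16 c161520ea942b178 — v1 0e4157a3 with clause (ii) ONE-BOND after idea-crit-5 #476-P2; PUBLISHED organ-level line,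
NOT registered — ★★OWNER RULING №36 (3)) reduces the PATH-B organ **S2β** `RunPairOrgan.OneLoop.FluctuationPartSmall` (registry `Lines/semiclassical_s2beta.lean` v11.4 3732b7df §2
:412, the item's `crux_decl`) and LINE g24-1's first-order row **GRAD∘** `OneBondOscillationCan` to ONE print-shaped row **POLY∘** `FluctuationPolymerCan`: on the window the
fluctuation part `log ρ + β_K·𝔄^reg` is a LOCALIZED SUM `c₀ + Σ_X T X` over finite bond sets with ONE-BOND window oscillations `w X` summable through one pin (`≤ φ_J`) and through two
pins (`≤ φ_J·e^{−κ·tdist}`), `φ` super-polynomial, `K`-uniform — the OUTPUT FORM of [Balaban1987RG1] Thm 1 p.259 with (0.24)–(0.25) p.257 and [Balaban1989LargeFieldII] (1.98)–(1.100)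
p.390.  This file is the `Theorems/`-side edition of the line's junctions, with every organ row PASTED VERBATIM as a hypothesis ∕ conclusion (no `def`; door-fit into the
Lines file by `exact`), over the importable pin algebra ✓`…PolymerPinAlgebra` — plus ONE NEW REDUCTION:
* §1 ★ `fluctuationPartSmall_of_polymer : ⟨POLY∘⟩ → ⟨S2β⟩` and ★ `oneBondOscillation_of_polymer : ⟨POLY∘⟩ → ⟨GRAD∘⟩` (the ideator's ★ junctions; proofs lifted, credit g24);
* §2 ★★ `polymerCan_of_polymerNorm : ⟨POLYⁿ∘⟩ → ⟨POLY∘⟩` (NEW) — **POLYⁿ∘** = POLY∘'s frame and its clauses (i) locality, (ii) window oscillation, (v) representation VERBATIM,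
  (v2: (ii) is the ONE-BOND oscillation clause) with the two summed clauses (iii) one-pin + (iv) two-pin REPLACED by `(∀ X, 0 ≤ w X)` and ONE weighted one-pin POLYMER-NORM clause
  `∀ b, Σ_{X ∋ b} w X · exp (κ · tdiam X) ≤ φ J`, `tdiam X := X.sup (e ↦ X.sup (e′ ↦ tdist e.src e′.src))` (the polymer's site-diameter in lattice steps) — SAME `φ`,
  SAME `κ`; by ✓`pinnedSum_le_of_normSum` ∕ ✓`twoPinnedSum_le_of_normSum` ∕ ✓`cast_dist_le_cast_supDiam`.  This is print's own currency: a per-term `e^{−κ·d_j(X)}` read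
  against the one-pin lattice-animal resummation (1.26) p.8 of [Balaban1988RG2Cluster] (tree length dominates diameter); ★★ `fluctuationPartSmall_of_polymerNorm :
  ⟨POLYⁿ∘⟩ → ⟨S2β⟩`, ★★ `oneBondOscillation_of_polymerNorm : ⟨POLYⁿ∘⟩ → ⟨GRAD∘⟩`.

NET FOR THE CENSUS.  LINE g24-3's cone {POLY∘} gains the edition {POLYⁿ∘} (one clause fewer, polymer-norm currency); the organ S2β and GRAD∘ are `Theorems/` theorems
modulo either letter.  CREDITS NOTHING: POLY∘ ∕ POLYⁿ∘ are XL+ letters (transcribing RG1–RG2–LF-I–LF-II's output representation for the T³ scheme + the last Mayer step + the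
Schwarz corollary, the card's (a)–(d)); registry v11.4 0∕5 unchanged.

HONEST SCOPE.  Bookkeeping junctions + finite-sum algebra; nothing of Bałaban's is asserted or proved; POLY∘ ∕ POLYⁿ∘ ∕ S2β ∕ GRAD∘ ∕ the five registered ∘-rows ∕
`FluctuationComparisonRegPrIntL` (20520) NOT proved; no summit is proved by a helper; rung R3 = SU(2) YM₃ on T³ — NOT d = 4, NOT infinite volume, NOT a mass gap, NOT Clay.
Sorry-free, axioms standard.

References: T. Bałaban, CMP **109** (1987) 249–301 [Balaban1987RG1] (Thm 1 p.259; (0.22)–(0.23) p.256, (0.24)–(0.25) p.257, (0.29) p.258; (1.11)–(1.14) p.262); CMP **116** (1988) 1–22 [Balaban1988RG2Cluster]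
((1.26) p.8); CMP **122** (1989) 355–392 [Balaban1989LargeFieldII] ((1.98)–(1.100) p.390); CMP **102** (1985) 255–275 [Balaban1985UV3] (Thm 2 p.263, (41) p.266).
-/

set_option autoImplicit false

noncomputable section

namespace Summit.QuantumFields.YangMills.Theorems.FluctuationComparisonRegPrIntLPolymerNormKnit

open MeasureTheory Filter Topology Set
open scoped BigOperators
open Literature.MathematicalPhysics.QuantumFieldTheory.Balaban1983to89
open Literature.MathematicalPhysics.QuantumFieldTheory.Balaban1983to89.T3ContinuumYM3Torus
open Literature.MathematicalPhysics.QuantumFieldTheory.Balaban1983to89.T3NestedUnitLaws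
open Literature.MathematicalPhysics.QuantumFieldTheory.Balaban1983to89.T3UnitLawDensityEML
open Literature.MathematicalPhysics.QuantumFieldTheory.Balaban1983to89.T3UnitScaleTilt
open Literature.MathematicalPhysics.QuantumFieldTheory.Balaban1983to89.T3TiltDescent
open Literature.MathematicalPhysics.QuantumFieldTheory.Balaban1983to89.T3PrintedRegularMinimiser
open Literature.MathematicalPhysics.QuantumFieldTheory.Balaban1983to89.T3LevelShift
open Literature.MathematicalPhysics.QuantumFieldTheory.Balaban1983to89.Missing
open Literature.MathematicalPhysics.QuantumFieldTheory.Balaban1983to89.T4Continuum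
open Summit.QuantumFields.YangMills.Theorems.FluctuationComparisonRegPrIntLPolymerPinAlgebra

/-! ## §1 POLY∘ → S2β and POLY∘ → GRAD∘ (the ideator's ★ junctions, texts inline) -/

/-- ★ **POLY∘ → S2β** — hypothesis = POLY∘ `FluctuationPolymerCan` (LINE g24-3 §1) VERBATIM; conclusion = the organ S2β `FluctuationPartSmall` (registry
`Lines/semiclassical_s2beta.lean` v11.4 §2 :412 = `Lines/runpair_organ.lean` = `Lines/polymer_form.lean` §0) VERBATIM.  Pass the frame through, `φ_{S2β} := 2φ`, and apply the
two-pin algebra ✓`fourPoint_le_pinnedSum_oneBond` to the representation (proof lifted from the ideator's `fluctuationPartSmall_of_polymer`).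
[cite: Balaban1987RG1, Thm 1 p.259 and (0.24)-(0.25) p.257; Balaban1989LargeFieldII, (1.98)-(1.100) p.390; Balaban1985UV3, Thm 2 p.263 and (41) p.266] -/
theorem fluctuationPartSmall_of_polymer
    (hP : ∀ (L : ℕ), ∃ pS : ℝ, ∀ (b₀ p₀ : ℝ), 0 < b₀ → pS ≤ p₀ → 0 < p₀ → ∃ ε₁ : ℝ, 0 < ε₁ ∧ ∀ (ε₀ : ℝ), 0 < ε₀ → ε₀ ≤ ε₁ →
      ∃ γ₁ : ℝ, 0 < γ₁ ∧ ∃ κ : ℝ, 0 < κ ∧ ∀ (F : T3Family) (γ : ℝ), F.L = L → 0 < γ → γ ≤ γ₁ →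
        ∃ (φ : ℕ → ℝ), (∀ J, 0 ≤ φ J) ∧ (∀ a : ℕ, Tendsto (fun J : ℕ => ((J : ℝ) + 1) ^ a * φ J) atTop (𝓝 0)) ∧
          ∀ (ν : ℕ → (j : ℕ) → Measure (GaugeField (F.P j) 0 (Matrix.specialUnitaryGroup (Fin 2) ℂ))),
            (∀ K, ν K K = T4GenFunBounds.gibbsMeasure (F.P K) ((F.scheme ℰp γ).β K)) →
            (∀ K j, j < K → ν K j = Measure.map (descend F ℰp j) (ν K (j + 1))) →
            ∀ (J K : ℕ) (hJK : J ≤ K) (ρ : GaugeField (F.P J) 0 (Matrix.specialUnitaryGroup (Fin 2) ℂ) → ℝ),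
              (∀ U, PlaqSmall (θBal F.L γ b₀ p₀ J) U → 0 < ρ U) →
              ν K J = (fieldMeasure _ _ _).withDensity (fun U => ENNReal.ofReal (ρ U)) →
              ContinuousOn ρ {U | PlaqSmall (θBal F.L γ b₀ p₀ J) U} →
              ∃ (c₀ : ℝ) (T : Finset (PBond (F.P J) 0) → GaugeField (F.P J) 0 (Matrix.specialUnitaryGroup (Fin 2) ℂ) → ℝ)
                (w : Finset (PBond (F.P J) 0) → ℝ),
                (∀ (X : Finset (PBond (F.P J) 0)) (U V : GaugeField (F.P J) 0 (Matrix.specialUnitaryGroup (Fin 2) ℂ)),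
                    (∀ e ∈ X, U e = V e) → T X U = T X V) ∧
                (∀ (X : Finset (PBond (F.P J) 0)) (b : PBond (F.P J) 0) (U V : GaugeField (F.P J) 0 (Matrix.specialUnitaryGroup (Fin 2) ℂ)),
                    PlaqSmall (θBal F.L γ b₀ p₀ J) U → PlaqSmall (θBal F.L γ b₀ p₀ J) V → (∀ e, e ≠ b → U e = V e) → |T X U - T X V| ≤ w X) ∧
                (∀ b : PBond (F.P J) 0, ∑ X ∈ Finset.univ.filter (fun X => b ∈ X), w X ≤ φ J) ∧
                (∀ b b' : PBond (F.P J) 0,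
                    ∑ X ∈ Finset.univ.filter (fun X => b ∈ X ∧ b' ∈ X), w X ≤ φ J * Real.exp (-(κ * (b.src.tdist b'.src : ℝ)))) ∧
                (∀ U : GaugeField (F.P J) 0 (Matrix.specialUnitaryGroup (Fin 2) ℂ), PlaqSmall (θBal F.L γ b₀ p₀ J) U →
                    Real.log (ρ U) + (F.scheme ℰp γ).β K * minActionRegPr F J K hJK ε₀ U = c₀ + ∑ X, T X U)) :
    ∀ (L : ℕ), ∃ pS : ℝ, ∀ (b₀ p₀ : ℝ), 0 < b₀ → pS ≤ p₀ → 0 < p₀ → ∃ ε₁ : ℝ, 0 < ε₁ ∧ ∀ (ε₀ : ℝ), 0 < ε₀ → ε₀ ≤ ε₁ →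
      ∃ γ₁ : ℝ, 0 < γ₁ ∧ ∃ κ : ℝ, 0 < κ ∧ ∀ (F : T3Family) (γ : ℝ), F.L = L → 0 < γ → γ ≤ γ₁ →
        ∃ (φ : ℕ → ℝ), (∀ J, 0 ≤ φ J) ∧ Tendsto (fun J : ℕ => (J : ℝ) * φ J) atTop (𝓝 0) ∧
          ∀ (ν : ℕ → (j : ℕ) → Measure (GaugeField (F.P j) 0 (Matrix.specialUnitaryGroup (Fin 2) ℂ))),
            (∀ K, ν K K = T4GenFunBounds.gibbsMeasure (F.P K) ((F.scheme ℰp γ).β K)) →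
            (∀ K j, j < K → ν K j = Measure.map (descend F ℰp j) (ν K (j + 1))) →
            ∀ (J K : ℕ) (hJK : J ≤ K) (ρ : GaugeField (F.P J) 0 (Matrix.specialUnitaryGroup (Fin 2) ℂ) → ℝ),
              (∀ U, PlaqSmall (θBal F.L γ b₀ p₀ J) U → 0 < ρ U) →
              ν K J = (fieldMeasure _ _ _).withDensity (fun U => ENNReal.ofReal (ρ U)) →
              ContinuousOn ρ {U | PlaqSmall (θBal F.L γ b₀ p₀ J) U} →
              ∀ (b b' : PBond (F.P J) 0) (U V W Z : GaugeField (F.P J) 0 (Matrix.specialUnitaryGroup (Fin 2) ℂ)),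
                PlaqSmall (θBal F.L γ b₀ p₀ J) U → PlaqSmall (θBal F.L γ b₀ p₀ J) V →
                PlaqSmall (θBal F.L γ b₀ p₀ J) W → PlaqSmall (θBal F.L γ b₀ p₀ J) Z →
                (∀ e, e ≠ b → U e = V e) → (∀ e, e ≠ b' → U e = W e) → (∀ e, e ≠ b' → V e = Z e) → (∀ e, e ≠ b → W e = Z e) →
                |((Real.log (ρ U) + (F.scheme ℰp γ).β K * minActionRegPr F J K hJK ε₀ U)
                    - (Real.log (ρ V) + (F.scheme ℰp γ).β K * minActionRegPr F J K hJK ε₀ V))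
                  - ((Real.log (ρ W) + (F.scheme ℰp γ).β K * minActionRegPr F J K hJK ε₀ W)
                    - (Real.log (ρ Z) + (F.scheme ℰp γ).β K * minActionRegPr F J K hJK ε₀ Z))|
                  ≤ φ J * Real.exp (-(κ * (b.src.tdist b'.src : ℝ))) := by
  intro L
  obtain ⟨pS, HpS⟩ := hP L
  refine ⟨pS, ?_⟩
  intro b₀ p₀ hb₀ hpS hp₀
  obtain ⟨ε₁, hε₁, Hε⟩ := HpS b₀ p₀ hb₀ hpS hp₀
  refine ⟨ε₁, hε₁, ?_⟩
  intro ε₀ hε₀ hε₀₁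
  obtain ⟨γ₁, hγ₁, κ, hκ, HF⟩ := Hε ε₀ hε₀ hε₀₁
  refine ⟨γ₁, hγ₁, κ, hκ, ?_⟩
  intro F γ hFL hγ hγ₁'
  obtain ⟨φ, hφ0, hφ, Hν⟩ := HF F γ hFL hγ hγ₁'
  refine ⟨fun J => 2 * φ J, fun J => mul_nonneg (by norm_num) (hφ0 J), tendsto_mul_two_of_superpoly hφ0 hφ, ?_⟩
  intro ν hνK hνd J K hJK ρ hρpos hρν hρcont b b' U V W Z hU hV hW hZ hUV hUW hVZ hWZ
  obtain ⟨c₀, T, w, hloc, hosc, _h1, h2, hrep⟩ := Hν ν hνK hνd J K hJK ρ hρpos hρν hρcont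
  have key := fourPoint_le_pinnedSum_oneBond T w {U | PlaqSmall (θBal F.L γ b₀ p₀ J) U} c₀
    (fun U => Real.log (ρ U) + (F.scheme ℰp γ).β K * minActionRegPr F J K hJK ε₀ U)
    hloc (fun X e U V hU hV hUV => hosc X e U V hU hV hUV) (fun U hU => hrep U hU) b b' U V W Z hU hV hW hZ hUV hUW hVZ hWZ
  refine key.trans ?_
  rw [← Finset.mul_sum]
  calc 2 * ∑ X ∈ Finset.univ.filter (fun X => b ∈ X ∧ b' ∈ X), w X
      ≤ 2 * (φ J * Real.exp (-(κ * (b.src.tdist b'.src : ℝ)))) := by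
        exact mul_le_mul_of_nonneg_left (h2 b b') (by norm_num)
    _ = 2 * φ J * Real.exp (-(κ * (b.src.tdist b'.src : ℝ))) := by ring

/-- ★ **POLY∘ → GRAD∘** — hypothesis = POLY∘ VERBATIM; conclusion = GRAD∘ `OneBondOscillationCan` (LINE g24-1 `Lines/gradient_split.lean` §0 = `Lines/polymer_form.lean` §0)
VERBATIM.  Drop `κ`, `σ := φ`, one-pin algebra ✓`onePoint_le_pinnedSum_oneBond` (proof lifted from the ideator's `oneBondOscillation_of_polymer`).
[cite: Balaban1987RG1, Thm 1 p.259 and (0.24)-(0.25) p.257; Balaban1989LargeFieldII, (1.98)-(1.100) p.390] -/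
theorem oneBondOscillation_of_polymer
    (hP : ∀ (L : ℕ), ∃ pS : ℝ, ∀ (b₀ p₀ : ℝ), 0 < b₀ → pS ≤ p₀ → 0 < p₀ → ∃ ε₁ : ℝ, 0 < ε₁ ∧ ∀ (ε₀ : ℝ), 0 < ε₀ → ε₀ ≤ ε₁ →
      ∃ γ₁ : ℝ, 0 < γ₁ ∧ ∃ κ : ℝ, 0 < κ ∧ ∀ (F : T3Family) (γ : ℝ), F.L = L → 0 < γ → γ ≤ γ₁ →
        ∃ (φ : ℕ → ℝ), (∀ J, 0 ≤ φ J) ∧ (∀ a : ℕ, Tendsto (fun J : ℕ => ((J : ℝ) + 1) ^ a * φ J) atTop (𝓝 0)) ∧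
          ∀ (ν : ℕ → (j : ℕ) → Measure (GaugeField (F.P j) 0 (Matrix.specialUnitaryGroup (Fin 2) ℂ))),
            (∀ K, ν K K = T4GenFunBounds.gibbsMeasure (F.P K) ((F.scheme ℰp γ).β K)) →
            (∀ K j, j < K → ν K j = Measure.map (descend F ℰp j) (ν K (j + 1))) →
            ∀ (J K : ℕ) (hJK : J ≤ K) (ρ : GaugeField (F.P J) 0 (Matrix.specialUnitaryGroup (Fin 2) ℂ) → ℝ),
              (∀ U, PlaqSmall (θBal F.L γ b₀ p₀ J) U → 0 < ρ U) →
              ν K J = (fieldMeasure _ _ _).withDensity (fun U => ENNReal.ofReal (ρ U)) →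
              ContinuousOn ρ {U | PlaqSmall (θBal F.L γ b₀ p₀ J) U} →
              ∃ (c₀ : ℝ) (T : Finset (PBond (F.P J) 0) → GaugeField (F.P J) 0 (Matrix.specialUnitaryGroup (Fin 2) ℂ) → ℝ)
                (w : Finset (PBond (F.P J) 0) → ℝ),
                (∀ (X : Finset (PBond (F.P J) 0)) (U V : GaugeField (F.P J) 0 (Matrix.specialUnitaryGroup (Fin 2) ℂ)),
                    (∀ e ∈ X, U e = V e) → T X U = T X V) ∧
                (∀ (X : Finset (PBond (F.P J) 0)) (b : PBond (F.P J) 0) (U V : GaugeField (F.P J) 0 (Matrix.specialUnitaryGroup (Fin 2) ℂ)),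
                    PlaqSmall (θBal F.L γ b₀ p₀ J) U → PlaqSmall (θBal F.L γ b₀ p₀ J) V → (∀ e, e ≠ b → U e = V e) → |T X U - T X V| ≤ w X) ∧
                (∀ b : PBond (F.P J) 0, ∑ X ∈ Finset.univ.filter (fun X => b ∈ X), w X ≤ φ J) ∧
                (∀ b b' : PBond (F.P J) 0,
                    ∑ X ∈ Finset.univ.filter (fun X => b ∈ X ∧ b' ∈ X), w X ≤ φ J * Real.exp (-(κ * (b.src.tdist b'.src : ℝ)))) ∧
                (∀ U : GaugeField (F.P J) 0 (Matrix.specialUnitaryGroup (Fin 2) ℂ), PlaqSmall (θBal F.L γ b₀ p₀ J) U →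
                    Real.log (ρ U) + (F.scheme ℰp γ).β K * minActionRegPr F J K hJK ε₀ U = c₀ + ∑ X, T X U)) :
    ∀ (L : ℕ), ∃ pS : ℝ, ∀ (b₀ p₀ : ℝ), 0 < b₀ → pS ≤ p₀ → 0 < p₀ → ∃ ε₁ : ℝ, 0 < ε₁ ∧ ∀ (ε₀ : ℝ), 0 < ε₀ → ε₀ ≤ ε₁ →
      ∃ γ₁ : ℝ, 0 < γ₁ ∧ ∀ (F : T3Family) (γ : ℝ), F.L = L → 0 < γ → γ ≤ γ₁ →
        ∃ (σ : ℕ → ℝ), (∀ J, 0 ≤ σ J) ∧ (∀ a : ℕ, Tendsto (fun J : ℕ => ((J : ℝ) + 1) ^ a * σ J) atTop (𝓝 0)) ∧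
          ∀ (ν : ℕ → (j : ℕ) → Measure (GaugeField (F.P j) 0 (Matrix.specialUnitaryGroup (Fin 2) ℂ))),
            (∀ K, ν K K = T4GenFunBounds.gibbsMeasure (F.P K) ((F.scheme ℰp γ).β K)) →
            (∀ K j, j < K → ν K j = Measure.map (descend F ℰp j) (ν K (j + 1))) →
            ∀ (J K : ℕ) (hJK : J ≤ K) (ρ : GaugeField (F.P J) 0 (Matrix.specialUnitaryGroup (Fin 2) ℂ) → ℝ),
              (∀ U, PlaqSmall (θBal F.L γ b₀ p₀ J) U → 0 < ρ U) →
              ν K J = (fieldMeasure _ _ _).withDensity (fun U => ENNReal.ofReal (ρ U)) →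
              ContinuousOn ρ {U | PlaqSmall (θBal F.L γ b₀ p₀ J) U} →
              ∀ (b : PBond (F.P J) 0) (U V : GaugeField (F.P J) 0 (Matrix.specialUnitaryGroup (Fin 2) ℂ)),
                PlaqSmall (θBal F.L γ b₀ p₀ J) U → PlaqSmall (θBal F.L γ b₀ p₀ J) V →
                (∀ e, e ≠ b → U e = V e) →
                |(Real.log (ρ U) + (F.scheme ℰp γ).β K * minActionRegPr F J K hJK ε₀ U)
                    - (Real.log (ρ V) + (F.scheme ℰp γ).β K * minActionRegPr F J K hJK ε₀ V)| ≤ σ J := by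
  intro L
  obtain ⟨pS, HpS⟩ := hP L
  refine ⟨pS, ?_⟩
  intro b₀ p₀ hb₀ hpS hp₀
  obtain ⟨ε₁, hε₁, Hε⟩ := HpS b₀ p₀ hb₀ hpS hp₀
  refine ⟨ε₁, hε₁, ?_⟩
  intro ε₀ hε₀ hε₀₁
  obtain ⟨γ₁, hγ₁, κ, _hκ, HF⟩ := Hε ε₀ hε₀ hε₀₁
  refine ⟨γ₁, hγ₁, ?_⟩
  intro F γ hFL hγ hγ₁'
  obtain ⟨φ, hφ0, hφ, Hν⟩ := HF F γ hFL hγ hγ₁'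
  refine ⟨φ, hφ0, hφ, ?_⟩
  intro ν hνK hνd J K hJK ρ hρpos hρν hρcont b U V hU hV hUV
  obtain ⟨c₀, T, w, hloc, hosc, h1, _h2, hrep⟩ := Hν ν hνK hνd J K hJK ρ hρpos hρν hρcont
  have key := onePoint_le_pinnedSum_oneBond T w {U | PlaqSmall (θBal F.L γ b₀ p₀ J) U} c₀
    (fun U => Real.log (ρ U) + (F.scheme ℰp γ).β K * minActionRegPr F J K hJK ε₀ U)
    hloc (fun X e U V hU hV hUV => hosc X e U V hU hV hUV) (fun U hU => hrep U hU) b U V hU hV hUV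
  exact key.trans (h1 b)

/-! ## §2 NEW: POLYⁿ∘ → POLY∘ — the two summed clauses from ONE polymer-norm clause -/

/-- ★★ **POLYⁿ∘ → POLY∘** — hypothesis = **POLYⁿ∘** := POLY∘'s frame and clauses (i) locality, (ii) window oscillation, (v) representation VERBATIM, with (iii)+(iv)
REPLACED by non-negativity of the weights and ONE weighted one-pin POLYMER-NORM clause `Σ_{X ∋ b} w X · exp (κ · tdiam X) ≤ φ J`, `tdiam X` the `sup`-diameter of the
polymer's bond sources in lattice steps (`Setup.Site.tdist`); conclusion = POLY∘ VERBATIM with the SAME `φ`, `κ`.  One pin: ✓`pinnedSum_le_of_normSum` (`e^{κ·tdiam} ≥ 1`);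
two pins: ✓`twoPinnedSum_le_of_normSum` with ✓`cast_dist_le_cast_supDiam` (`b, b′ ∈ X ⇒ tdist b.src b′.src ≤ tdiam X`).  Print's currency: per-term `e^{−κ d_j(X)}` decay
(0.25) against the one-pin resummation (1.26). [cite: Balaban1987RG1, (0.24)-(0.25) p.257; Balaban1988RG2Cluster, (1.26) p.8; Balaban1989LargeFieldII, (1.98)-(1.100) p.390] -/
theorem polymerCan_of_polymerNorm
    (hN : ∀ (L : ℕ), ∃ pS : ℝ, ∀ (b₀ p₀ : ℝ), 0 < b₀ → pS ≤ p₀ → 0 < p₀ → ∃ ε₁ : ℝ, 0 < ε₁ ∧ ∀ (ε₀ : ℝ), 0 < ε₀ → ε₀ ≤ ε₁ →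
      ∃ γ₁ : ℝ, 0 < γ₁ ∧ ∃ κ : ℝ, 0 < κ ∧ ∀ (F : T3Family) (γ : ℝ), F.L = L → 0 < γ → γ ≤ γ₁ →
        ∃ (φ : ℕ → ℝ), (∀ J, 0 ≤ φ J) ∧ (∀ a : ℕ, Tendsto (fun J : ℕ => ((J : ℝ) + 1) ^ a * φ J) atTop (𝓝 0)) ∧
          ∀ (ν : ℕ → (j : ℕ) → Measure (GaugeField (F.P j) 0 (Matrix.specialUnitaryGroup (Fin 2) ℂ))),
            (∀ K, ν K K = T4GenFunBounds.gibbsMeasure (F.P K) ((F.scheme ℰp γ).β K)) →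
            (∀ K j, j < K → ν K j = Measure.map (descend F ℰp j) (ν K (j + 1))) →
            ∀ (J K : ℕ) (hJK : J ≤ K) (ρ : GaugeField (F.P J) 0 (Matrix.specialUnitaryGroup (Fin 2) ℂ) → ℝ),
              (∀ U, PlaqSmall (θBal F.L γ b₀ p₀ J) U → 0 < ρ U) →
              ν K J = (fieldMeasure _ _ _).withDensity (fun U => ENNReal.ofReal (ρ U)) →
              ContinuousOn ρ {U | PlaqSmall (θBal F.L γ b₀ p₀ J) U} →
              ∃ (c₀ : ℝ) (T : Finset (PBond (F.P J) 0) → GaugeField (F.P J) 0 (Matrix.specialUnitaryGroup (Fin 2) ℂ) → ℝ)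
                (w : Finset (PBond (F.P J) 0) → ℝ),
                (∀ (X : Finset (PBond (F.P J) 0)) (U V : GaugeField (F.P J) 0 (Matrix.specialUnitaryGroup (Fin 2) ℂ)),
                    (∀ e ∈ X, U e = V e) → T X U = T X V) ∧
                (∀ (X : Finset (PBond (F.P J) 0)) (b : PBond (F.P J) 0) (U V : GaugeField (F.P J) 0 (Matrix.specialUnitaryGroup (Fin 2) ℂ)),
                    PlaqSmall (θBal F.L γ b₀ p₀ J) U → PlaqSmall (θBal F.L γ b₀ p₀ J) V → (∀ e, e ≠ b → U e = V e) → |T X U - T X V| ≤ w X) ∧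
                (∀ X : Finset (PBond (F.P J) 0), 0 ≤ w X) ∧
                (∀ b : PBond (F.P J) 0, ∑ X ∈ Finset.univ.filter (fun X => b ∈ X),
                    w X * Real.exp (κ * ((X.sup fun e => X.sup fun e' => e.src.tdist e'.src : ℕ) : ℝ)) ≤ φ J) ∧
                (∀ U : GaugeField (F.P J) 0 (Matrix.specialUnitaryGroup (Fin 2) ℂ), PlaqSmall (θBal F.L γ b₀ p₀ J) U →
                    Real.log (ρ U) + (F.scheme ℰp γ).β K * minActionRegPr F J K hJK ε₀ U = c₀ + ∑ X, T X U)) :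
    ∀ (L : ℕ), ∃ pS : ℝ, ∀ (b₀ p₀ : ℝ), 0 < b₀ → pS ≤ p₀ → 0 < p₀ → ∃ ε₁ : ℝ, 0 < ε₁ ∧ ∀ (ε₀ : ℝ), 0 < ε₀ → ε₀ ≤ ε₁ →
      ∃ γ₁ : ℝ, 0 < γ₁ ∧ ∃ κ : ℝ, 0 < κ ∧ ∀ (F : T3Family) (γ : ℝ), F.L = L → 0 < γ → γ ≤ γ₁ →
        ∃ (φ : ℕ → ℝ), (∀ J, 0 ≤ φ J) ∧ (∀ a : ℕ, Tendsto (fun J : ℕ => ((J : ℝ) + 1) ^ a * φ J) atTop (𝓝 0)) ∧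
          ∀ (ν : ℕ → (j : ℕ) → Measure (GaugeField (F.P j) 0 (Matrix.specialUnitaryGroup (Fin 2) ℂ))),
            (∀ K, ν K K = T4GenFunBounds.gibbsMeasure (F.P K) ((F.scheme ℰp γ).β K)) →
            (∀ K j, j < K → ν K j = Measure.map (descend F ℰp j) (ν K (j + 1))) →
            ∀ (J K : ℕ) (hJK : J ≤ K) (ρ : GaugeField (F.P J) 0 (Matrix.specialUnitaryGroup (Fin 2) ℂ) → ℝ),
              (∀ U, PlaqSmall (θBal F.L γ b₀ p₀ J) U → 0 < ρ U) →
              ν K J = (fieldMeasure _ _ _).withDensity (fun U => ENNReal.ofReal (ρ U)) →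
              ContinuousOn ρ {U | PlaqSmall (θBal F.L γ b₀ p₀ J) U} →
              ∃ (c₀ : ℝ) (T : Finset (PBond (F.P J) 0) → GaugeField (F.P J) 0 (Matrix.specialUnitaryGroup (Fin 2) ℂ) → ℝ)
                (w : Finset (PBond (F.P J) 0) → ℝ),
                (∀ (X : Finset (PBond (F.P J) 0)) (U V : GaugeField (F.P J) 0 (Matrix.specialUnitaryGroup (Fin 2) ℂ)),
                    (∀ e ∈ X, U e = V e) → T X U = T X V) ∧
                (∀ (X : Finset (PBond (F.P J) 0)) (b : PBond (F.P J) 0) (U V : GaugeField (F.P J) 0 (Matrix.specialUnitaryGroup (Fin 2) ℂ)),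
                    PlaqSmall (θBal F.L γ b₀ p₀ J) U → PlaqSmall (θBal F.L γ b₀ p₀ J) V → (∀ e, e ≠ b → U e = V e) → |T X U - T X V| ≤ w X) ∧
                (∀ b : PBond (F.P J) 0, ∑ X ∈ Finset.univ.filter (fun X => b ∈ X), w X ≤ φ J) ∧
                (∀ b b' : PBond (F.P J) 0,
                    ∑ X ∈ Finset.univ.filter (fun X => b ∈ X ∧ b' ∈ X), w X ≤ φ J * Real.exp (-(κ * (b.src.tdist b'.src : ℝ)))) ∧
                (∀ U : GaugeField (F.P J) 0 (Matrix.specialUnitaryGroup (Fin 2) ℂ), PlaqSmall (θBal F.L γ b₀ p₀ J) U →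
                    Real.log (ρ U) + (F.scheme ℰp γ).β K * minActionRegPr F J K hJK ε₀ U = c₀ + ∑ X, T X U) := by
  intro L
  obtain ⟨pS, HpS⟩ := hN L
  refine ⟨pS, ?_⟩
  intro b₀ p₀ hb₀ hpS hp₀
  obtain ⟨ε₁, hε₁, Hε⟩ := HpS b₀ p₀ hb₀ hpS hp₀
  refine ⟨ε₁, hε₁, ?_⟩
  intro ε₀ hε₀ hε₀₁
  obtain ⟨γ₁, hγ₁, κ, hκ, HF⟩ := Hε ε₀ hε₀ hε₀₁
  refine ⟨γ₁, hγ₁, κ, hκ, ?_⟩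
  intro F γ hFL hγ hγ₁'
  obtain ⟨φ, hφ0, hφ, Hν⟩ := HF F γ hFL hγ hγ₁'
  refine ⟨φ, hφ0, hφ, ?_⟩
  intro ν hνK hνd J K hJK ρ hρpos hρν hρcont
  obtain ⟨c₀, T, w, hloc, hosc, hw0, hnorm, hrep⟩ := Hν ν hνK hνd J K hJK ρ hρpos hρν hρcont
  refine ⟨c₀, T, w, hloc, hosc, fun b => ?_, fun b b' => ?_, hrep⟩
  · exact pinnedSum_le_of_normSum w (fun X => ((X.sup fun e => X.sup fun e' => e.src.tdist e'.src : ℕ) : ℝ)) hκ.le hw0 b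
      (fun X _ => Nat.cast_nonneg _) (hnorm b)
  · exact twoPinnedSum_le_of_normSum w (fun X => ((X.sup fun e => X.sup fun e' => e.src.tdist e'.src : ℕ) : ℝ))
      (fun e e' => (e.src.tdist e'.src : ℝ)) hκ.le hw0
      (fun X e he e' he' => cast_dist_le_cast_supDiam (fun a a' : PBond (F.P J) 0 => a.src.tdist a'.src) X he he') b b' (hnorm b)

/-- ★★ **POLYⁿ∘ → S2β** (composition of §2 with §1): the organ S2β `FluctuationPartSmall` VERBATIM from the polymer-norm edition POLYⁿ∘.
[cite: Balaban1987RG1, Thm 1 p.259 and (0.24)-(0.25) p.257; Balaban1988RG2Cluster, (1.26) p.8; Balaban1985UV3, Thm 2 p.263 and (41) p.266] -/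
theorem fluctuationPartSmall_of_polymerNorm
    (hN : ∀ (L : ℕ), ∃ pS : ℝ, ∀ (b₀ p₀ : ℝ), 0 < b₀ → pS ≤ p₀ → 0 < p₀ → ∃ ε₁ : ℝ, 0 < ε₁ ∧ ∀ (ε₀ : ℝ), 0 < ε₀ → ε₀ ≤ ε₁ →
      ∃ γ₁ : ℝ, 0 < γ₁ ∧ ∃ κ : ℝ, 0 < κ ∧ ∀ (F : T3Family) (γ : ℝ), F.L = L → 0 < γ → γ ≤ γ₁ →
        ∃ (φ : ℕ → ℝ), (∀ J, 0 ≤ φ J) ∧ (∀ a : ℕ, Tendsto (fun J : ℕ => ((J : ℝ) + 1) ^ a * φ J) atTop (𝓝 0)) ∧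
          ∀ (ν : ℕ → (j : ℕ) → Measure (GaugeField (F.P j) 0 (Matrix.specialUnitaryGroup (Fin 2) ℂ))),
            (∀ K, ν K K = T4GenFunBounds.gibbsMeasure (F.P K) ((F.scheme ℰp γ).β K)) →
            (∀ K j, j < K → ν K j = Measure.map (descend F ℰp j) (ν K (j + 1))) →
            ∀ (J K : ℕ) (hJK : J ≤ K) (ρ : GaugeField (F.P J) 0 (Matrix.specialUnitaryGroup (Fin 2) ℂ) → ℝ),
              (∀ U, PlaqSmall (θBal F.L γ b₀ p₀ J) U → 0 < ρ U) →
              ν K J = (fieldMeasure _ _ _).withDensity (fun U => ENNReal.ofReal (ρ U)) →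
              ContinuousOn ρ {U | PlaqSmall (θBal F.L γ b₀ p₀ J) U} →
              ∃ (c₀ : ℝ) (T : Finset (PBond (F.P J) 0) → GaugeField (F.P J) 0 (Matrix.specialUnitaryGroup (Fin 2) ℂ) → ℝ)
                (w : Finset (PBond (F.P J) 0) → ℝ),
                (∀ (X : Finset (PBond (F.P J) 0)) (U V : GaugeField (F.P J) 0 (Matrix.specialUnitaryGroup (Fin 2) ℂ)),
                    (∀ e ∈ X, U e = V e) → T X U = T X V) ∧
                (∀ (X : Finset (PBond (F.P J) 0)) (b : PBond (F.P J) 0) (U V : GaugeField (F.P J) 0 (Matrix.specialUnitaryGroup (Fin 2) ℂ)),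
                    PlaqSmall (θBal F.L γ b₀ p₀ J) U → PlaqSmall (θBal F.L γ b₀ p₀ J) V → (∀ e, e ≠ b → U e = V e) → |T X U - T X V| ≤ w X) ∧
                (∀ X : Finset (PBond (F.P J) 0), 0 ≤ w X) ∧
                (∀ b : PBond (F.P J) 0, ∑ X ∈ Finset.univ.filter (fun X => b ∈ X),
                    w X * Real.exp (κ * ((X.sup fun e => X.sup fun e' => e.src.tdist e'.src : ℕ) : ℝ)) ≤ φ J) ∧
                (∀ U : GaugeField (F.P J) 0 (Matrix.specialUnitaryGroup (Fin 2) ℂ), PlaqSmall (θBal F.L γ b₀ p₀ J) U →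
                    Real.log (ρ U) + (F.scheme ℰp γ).β K * minActionRegPr F J K hJK ε₀ U = c₀ + ∑ X, T X U)) :
    ∀ (L : ℕ), ∃ pS : ℝ, ∀ (b₀ p₀ : ℝ), 0 < b₀ → pS ≤ p₀ → 0 < p₀ → ∃ ε₁ : ℝ, 0 < ε₁ ∧ ∀ (ε₀ : ℝ), 0 < ε₀ → ε₀ ≤ ε₁ →
      ∃ γ₁ : ℝ, 0 < γ₁ ∧ ∃ κ : ℝ, 0 < κ ∧ ∀ (F : T3Family) (γ : ℝ), F.L = L → 0 < γ → γ ≤ γ₁ →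
        ∃ (φ : ℕ → ℝ), (∀ J, 0 ≤ φ J) ∧ Tendsto (fun J : ℕ => (J : ℝ) * φ J) atTop (𝓝 0) ∧
          ∀ (ν : ℕ → (j : ℕ) → Measure (GaugeField (F.P j) 0 (Matrix.specialUnitaryGroup (Fin 2) ℂ))),
            (∀ K, ν K K = T4GenFunBounds.gibbsMeasure (F.P K) ((F.scheme ℰp γ).β K)) →
            (∀ K j, j < K → ν K j = Measure.map (descend F ℰp j) (ν K (j + 1))) →
            ∀ (J K : ℕ) (hJK : J ≤ K) (ρ : GaugeField (F.P J) 0 (Matrix.specialUnitaryGroup (Fin 2) ℂ) → ℝ),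
              (∀ U, PlaqSmall (θBal F.L γ b₀ p₀ J) U → 0 < ρ U) →
              ν K J = (fieldMeasure _ _ _).withDensity (fun U => ENNReal.ofReal (ρ U)) →
              ContinuousOn ρ {U | PlaqSmall (θBal F.L γ b₀ p₀ J) U} →
              ∀ (b b' : PBond (F.P J) 0) (U V W Z : GaugeField (F.P J) 0 (Matrix.specialUnitaryGroup (Fin 2) ℂ)),
                PlaqSmall (θBal F.L γ b₀ p₀ J) U → PlaqSmall (θBal F.L γ b₀ p₀ J) V →
                PlaqSmall (θBal F.L γ b₀ p₀ J) W → PlaqSmall (θBal F.L γ b₀ p₀ J) Z →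
                (∀ e, e ≠ b → U e = V e) → (∀ e, e ≠ b' → U e = W e) → (∀ e, e ≠ b' → V e = Z e) → (∀ e, e ≠ b → W e = Z e) →
                |((Real.log (ρ U) + (F.scheme ℰp γ).β K * minActionRegPr F J K hJK ε₀ U)
                    - (Real.log (ρ V) + (F.scheme ℰp γ).β K * minActionRegPr F J K hJK ε₀ V))
                  - ((Real.log (ρ W) + (F.scheme ℰp γ).β K * minActionRegPr F J K hJK ε₀ W)
                    - (Real.log (ρ Z) + (F.scheme ℰp γ).β K * minActionRegPr F J K hJK ε₀ Z))|
                  ≤ φ J * Real.exp (-(κ * (b.src.tdist b'.src : ℝ))) :=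
  fluctuationPartSmall_of_polymer (polymerCan_of_polymerNorm hN)

/-- ★★ **POLYⁿ∘ → GRAD∘** (composition of §2 with §1): LINE g24-1's first-order row GRAD∘ `OneBondOscillationCan` VERBATIM from the polymer-norm edition POLYⁿ∘.
[cite: Balaban1987RG1, Thm 1 p.259 and (0.24)-(0.25) p.257; Balaban1988RG2Cluster, (1.26) p.8; Balaban1989LargeFieldII, (1.98)-(1.100) p.390] -/
theorem oneBondOscillation_of_polymerNorm
    (hN : ∀ (L : ℕ), ∃ pS : ℝ, ∀ (b₀ p₀ : ℝ), 0 < b₀ → pS ≤ p₀ → 0 < p₀ → ∃ ε₁ : ℝ, 0 < ε₁ ∧ ∀ (ε₀ : ℝ), 0 < ε₀ → ε₀ ≤ ε₁ →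
      ∃ γ₁ : ℝ, 0 < γ₁ ∧ ∃ κ : ℝ, 0 < κ ∧ ∀ (F : T3Family) (γ : ℝ), F.L = L → 0 < γ → γ ≤ γ₁ →
        ∃ (φ : ℕ → ℝ), (∀ J, 0 ≤ φ J) ∧ (∀ a : ℕ, Tendsto (fun J : ℕ => ((J : ℝ) + 1) ^ a * φ J) atTop (𝓝 0)) ∧
          ∀ (ν : ℕ → (j : ℕ) → Measure (GaugeField (F.P j) 0 (Matrix.specialUnitaryGroup (Fin 2) ℂ))),
            (∀ K, ν K K = T4GenFunBounds.gibbsMeasure (F.P K) ((F.scheme ℰp γ).β K)) →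
            (∀ K j, j < K → ν K j = Measure.map (descend F ℰp j) (ν K (j + 1))) →
            ∀ (J K : ℕ) (hJK : J ≤ K) (ρ : GaugeField (F.P J) 0 (Matrix.specialUnitaryGroup (Fin 2) ℂ) → ℝ),
              (∀ U, PlaqSmall (θBal F.L γ b₀ p₀ J) U → 0 < ρ U) →
              ν K J = (fieldMeasure _ _ _).withDensity (fun U => ENNReal.ofReal (ρ U)) →
              ContinuousOn ρ {U | PlaqSmall (θBal F.L γ b₀ p₀ J) U} →
              ∃ (c₀ : ℝ) (T : Finset (PBond (F.P J) 0) → GaugeField (F.P J) 0 (Matrix.specialUnitaryGroup (Fin 2) ℂ) → ℝ)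
                (w : Finset (PBond (F.P J) 0) → ℝ),
                (∀ (X : Finset (PBond (F.P J) 0)) (U V : GaugeField (F.P J) 0 (Matrix.specialUnitaryGroup (Fin 2) ℂ)),
                    (∀ e ∈ X, U e = V e) → T X U = T X V) ∧
                (∀ (X : Finset (PBond (F.P J) 0)) (b : PBond (F.P J) 0) (U V : GaugeField (F.P J) 0 (Matrix.specialUnitaryGroup (Fin 2) ℂ)),
                    PlaqSmall (θBal F.L γ b₀ p₀ J) U → PlaqSmall (θBal F.L γ b₀ p₀ J) V → (∀ e, e ≠ b → U e = V e) → |T X U - T X V| ≤ w X) ∧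
                (∀ X : Finset (PBond (F.P J) 0), 0 ≤ w X) ∧
                (∀ b : PBond (F.P J) 0, ∑ X ∈ Finset.univ.filter (fun X => b ∈ X),
                    w X * Real.exp (κ * ((X.sup fun e => X.sup fun e' => e.src.tdist e'.src : ℕ) : ℝ)) ≤ φ J) ∧
                (∀ U : GaugeField (F.P J) 0 (Matrix.specialUnitaryGroup (Fin 2) ℂ), PlaqSmall (θBal F.L γ b₀ p₀ J) U →
                    Real.log (ρ U) + (F.scheme ℰp γ).β K * minActionRegPr F J K hJK ε₀ U = c₀ + ∑ X, T X U)) :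
    ∀ (L : ℕ), ∃ pS : ℝ, ∀ (b₀ p₀ : ℝ), 0 < b₀ → pS ≤ p₀ → 0 < p₀ → ∃ ε₁ : ℝ, 0 < ε₁ ∧ ∀ (ε₀ : ℝ), 0 < ε₀ → ε₀ ≤ ε₁ →
      ∃ γ₁ : ℝ, 0 < γ₁ ∧ ∀ (F : T3Family) (γ : ℝ), F.L = L → 0 < γ → γ ≤ γ₁ →
        ∃ (σ : ℕ → ℝ), (∀ J, 0 ≤ σ J) ∧ (∀ a : ℕ, Tendsto (fun J : ℕ => ((J : ℝ) + 1) ^ a * σ J) atTop (𝓝 0)) ∧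
          ∀ (ν : ℕ → (j : ℕ) → Measure (GaugeField (F.P j) 0 (Matrix.specialUnitaryGroup (Fin 2) ℂ))),
            (∀ K, ν K K = T4GenFunBounds.gibbsMeasure (F.P K) ((F.scheme ℰp γ).β K)) →
            (∀ K j, j < K → ν K j = Measure.map (descend F ℰp j) (ν K (j + 1))) →
            ∀ (J K : ℕ) (hJK : J ≤ K) (ρ : GaugeField (F.P J) 0 (Matrix.specialUnitaryGroup (Fin 2) ℂ) → ℝ),
              (∀ U, PlaqSmall (θBal F.L γ b₀ p₀ J) U → 0 < ρ U) →
              ν K J = (fieldMeasure _ _ _).withDensity (fun U => ENNReal.ofReal (ρ U)) →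
              ContinuousOn ρ {U | PlaqSmall (θBal F.L γ b₀ p₀ J) U} →
              ∀ (b : PBond (F.P J) 0) (U V : GaugeField (F.P J) 0 (Matrix.specialUnitaryGroup (Fin 2) ℂ)),
                PlaqSmall (θBal F.L γ b₀ p₀ J) U → PlaqSmall (θBal F.L γ b₀ p₀ J) V →
                (∀ e, e ≠ b → U e = V e) →
                |(Real.log (ρ U) + (F.scheme ℰp γ).β K * minActionRegPr F J K hJK ε₀ U)
                    - (Real.log (ρ V) + (F.scheme ℰp γ).β K * minActionRegPr F J K hJK ε₀ V)| ≤ σ J :=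
  oneBondOscillation_of_polymer (polymerCan_of_polymerNorm hN)

end Summit.QuantumFields.YangMills.Theorems.FluctuationComparisonRegPrIntLPolymerNormKnit

end
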